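import Literature.NumberTheory.LFunctions.GaussianHeckeConvexity
import Literature.NumberTheory.LFunctions.GaussianHeckePrimeSumBookkeeping
import Literature.NumberTheory.LFunctions.RieszPerronOrderThree
import Literature.NumberTheory.LFunctions.RichertBoundsFromExpSum
import HarnessLib

/-!
# A Richert-type bound for the Hecke `L`-functions `L(s, λ^m)` of `ℚ(i)` from a Vinogradov-type bound
# for the lattice exponential sums `∑_{M < N z ≤ u} λ^m(z) N(z)^{-it}`

Topic `Literature/NumberTheory/LFunctions`.  This file introduces TWO definitions — the explicit finite
lattice sum `latticeBlockSum m t M u = ∑_{M < N z ≤ u} λ^m(z) N(z)^{-it}` and a parametrised HYPOTHESIS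
`LatticeExpSumBound C D` (a predicate in the constants `(C, D)`, in the spirit of the tree's `ExpSumBound C D` of
`RichertBoundsFromExpSum.lean`; NOT a named fact) — and PROVES the deduction

  `LatticeExpSumBound C D ⟹ ∃ A, ∀ m ≥ 1, 1/2 ≤ σ ≤ 2, t ∈ ℝ:`
  `‖D_m(σ + it)‖ ≤ A · log V · V^{B_D · max(1−σ,0)^{3/2}}`,  `V = m + |t| + 3`, `B_D = (2/3)√(D/3)`

(`exists_richert_of_latticeExpSumBound`), where `D_m = GaussianHecke.heckeL m = 4 L(·, λ^m)` is the continued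
Dirichlet series of the angular characters `λ^m(z) = (z/|z|)^{4m}` (`GaussianHeckeThetaMellin.lean`).  This is
the `ℚ(i)`-analogue of "Ford's Theorem 2 ⟹ Richert's bound" (`RichertBoundsFromExpSum.lean`,
Titchmarsh §5.3 / Ford 2002 Lemma 7.3) and the second step of the in-tree proof of M. D. Coleman's zero-free
region for these `L`-functions (Mathematika 37 (1990), Theorem 2; `GaussianHeckeColemanZFR.lean`).

Proof: Perron's formula of order three for `f(n) = c_m(n) n^{-s₀}` (`c_m(n) = ∑_{N z = n} λ^m(z)`) at
`Re u = c = max(1−σ,0) + 1/log V`, shifted to `Re u = −3/4` across `u = 0`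
(`Literature.NumberTheory.LFunctions.RieszPerron3.norm_apply_zero_le`, with the convexity bound
`‖D_m(z)‖ ≤ D₀(|Im z| + 2m + 4)²` of `GaussianHeckeConvexity.lean` on `−1/2 ≤ Re z ≤ 3`), `x = V⁴`:
`‖D_m(s₀)‖ ≤ ‖∑_{n ≤ x} c_m(n) n^{-it} · n^{-σ}(1 − n/x)³‖ + O(1)`; the sum is cut into dyadic blocks
`(2^j, 2^{j+1}]`, each estimated by partial summation from the hypothesis, and
`(2^j)^{1−σ} e^{−(j log 2)³/(D log²V)} ≤ V^{B_D(1−σ)^{3/2}}` (`RichertFromExpSum.cubic_bound`).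

## References

* M. D. Coleman, *A zero-free region for the Hecke L-functions*, Mathematika 37 (1990), 287–304, §§5–6.
  [cite: ColemanMathematika1990, Theorem 2]
* E. C. Titchmarsh, *The Theory of the Riemann Zeta-Function*, 2nd ed. (1986), §5.3. [cite: Titchmarsh1986, §5.3]
* K. Ford, *Vinogradov's integral and bounds for the Riemann zeta function*, Proc. LMS 85 (2002), Lemma 7.3.
  [cite: Ford2002, Lemma 7.3]
-/

noncomputable section

open Complex Finset Real

namespace Literature.NumberTheory.LFunctions

namespace GaussianHecke

open GaussianInt GaussianTheta RichertFromExpSum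

/-! ## The lattice block sums and the hypothesis -/

/-- The lattice exponential sum over an annulus: `∑_{M < N(z) ≤ u} λ^m(z) N(z)^{-it}` (`z ∈ ℤ[i]`).
[cite: ColemanMathematika1990, Theorem 1] -/
def latticeBlockSum (m : ℕ) (t : ℝ) (M u : ℕ) : ℂ :=
  ∑ z ∈ (normLE (u : ℝ)).filter (fun z : GaussianInt ↦ (M : ℤ) < z.norm),
    angularChar m z * (((z.norm : ℝ)) : ℂ) ^ (-(t * I))

/-- **A Vinogradov–Korobov bound for the lattice sums, as a predicate** in the constants `(C, D)`: for all
`m ≥ 1`, real `t`, `1 ≤ M ≤ u ≤ 2M` with `M ≤ V⁴`, `V = m + |t| + 3`,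
`‖∑_{M < N z ≤ u} λ^m(z) N(z)^{-it}‖ ≤ C · M^{1 − (log M)²/(D (log V)²)}`.
This is the shape of Coleman's Theorem 1 (Mathematika 37 (1990)) for `K = ℚ(i)` in Ford's normalisation
(`ExpSumBound`); a DEFINITION, the hypothesis of `exists_richert_of_latticeExpSumBound` — not asserted here.
[cite: ColemanMathematika1990, Theorem 1] -/
def LatticeExpSumBound (C D : ℝ) : Prop :=
  ∀ (m : ℕ) (t : ℝ) (M u : ℕ), 1 ≤ m → 1 ≤ M → M ≤ u → u ≤ 2 * M →
    (M : ℝ) ≤ ((m : ℝ) + |t| + 3) ^ 4 →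
      ‖latticeBlockSum m t M u‖ ≤ C * (M : ℝ) ^ (1 - Real.log M ^ 2 / (D * Real.log ((m : ℝ) + |t| + 3) ^ 2))

/-- `natAbs (N z) = n ↔ N z = n`. [folklore] -/
theorem natAbs_norm_eq_iff (z : GaussianInt) (n : ℕ) : z.norm.natAbs = n ↔ z.norm = n := by
  have h0 := GaussianInt.norm_nonneg z
  constructor
  · intro h; rw [← Int.natAbs_of_nonneg h0, h]
  · intro h; rw [h]; simp

/-- **Regrouping by the norm**: `∑_{M < n ≤ u} c_m(n) n^{-it} = ∑_{M < N z ≤ u} λ^m(z) N(z)^{-it}`. [folklore] -/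
theorem sum_Ioc_cCoeff_mul_eq (m : ℕ) (t : ℝ) (M u : ℕ) :
    ∑ n ∈ Ioc M u, cCoeff m n * (n : ℂ) ^ (-(t * I)) = latticeBlockSum m t M u := by
  classical
  unfold latticeBlockSum
  have hmaps : ∀ z ∈ (normLE (u : ℝ)).filter (fun z : GaussianInt ↦ (M : ℤ) < z.norm),
      z.norm.natAbs ∈ Ioc M u := by
    intro z hz
    rw [mem_filter, mem_normLE] at hz
    have h0 := GaussianInt.norm_nonneg z
    have e : (z.norm.natAbs : ℤ) = z.norm := Int.natAbs_of_nonneg h0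
    rw [mem_Ioc]
    constructor
    · have h1 : (M : ℤ) < (z.norm.natAbs : ℤ) := by rw [e]; exact hz.2
      exact_mod_cast h1
    · have h1 : ((z.norm.natAbs : ℤ) : ℝ) ≤ u := by rw [e]; exact hz.1
      exact_mod_cast h1
  rw [← sum_fiberwise_of_maps_to hmaps]
  refine sum_congr rfl fun n hn ↦ ?_
  rw [mem_Ioc] at hn
  have hfib : ((normLE (u : ℝ)).filter (fun z : GaussianInt ↦ (M : ℤ) < z.norm)).filter
      (fun z ↦ z.norm.natAbs = n) = normEq n := by
    ext z
    simp only [mem_filter, mem_normLE, mem_normEq, natAbs_norm_eq_iff]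
    constructor
    · rintro ⟨-, h⟩; exact h
    · intro h
      refine ⟨⟨?_, ?_⟩, h⟩
      · rw [h]; exact_mod_cast hn.2
      · rw [h]; exact_mod_cast hn.1
  rw [hfib, cCoeff, sum_mul]
  refine sum_congr rfl fun z hz ↦ ?_
  rw [mem_normEq] at hz
  rw [hz]
  norm_cast

/-! ## Partial summation on a block -/

/-- Partial sums of the extension by `0` below `M`: `∑_{i<k} [M < i] b(i) = ∑_{M < n ≤ k−1} b(n)`. [folklore] -/
theorem sum_range_ite_eq (b : ℕ → ℂ) (M k : ℕ) :
    ∑ i ∈ range k, (if M < i then b i else 0) = ∑ n ∈ Ioc M (k - 1), b n := by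
  rw [← sum_filter]
  congr 1
  ext i
  simp only [mem_filter, mem_range, mem_Ioc]
  omega

/-- **Partial summation on a block**: if `w ≥ 0` is non-increasing on `[M+1, M₂]` and
`‖∑_{M < n ≤ u} b(n)‖ ≤ B` for all `M ≤ u ≤ M₂`, then `‖∑_{M < n ≤ M₂} b(n) w(n)‖ ≤ 2 B w(M+1)` (`M < M₂`).
[folklore] -/
theorem norm_sum_Ioc_mul_le {b : ℕ → ℂ} {w : ℕ → ℝ} {M M₂ : ℕ} {B : ℝ} (h12 : M < M₂)
    (hw : ∀ i, M + 1 ≤ i → i < M₂ → w (i + 1) ≤ w i) (hw0 : 0 ≤ w M₂)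
    (hB : ∀ u, M ≤ u → u ≤ M₂ → ‖∑ n ∈ Ioc M u, b n‖ ≤ B) :
    ‖∑ n ∈ Ioc M M₂, b n * w n‖ ≤ 2 * B * w (M + 1) := by
  set a : ℕ → ℂ := fun i ↦ if M < i then b i else 0 with ha
  have hpart : ∀ k, M + 1 ≤ k → k ≤ M₂ + 1 → ‖∑ i ∈ range k, a i‖ ≤ B := by
    intro k hk1 hk2
    rw [ha, sum_range_ite_eq]
    exact hB (k - 1) (by omega) (by omega)
  have h := norm_sum_Icc_mul_le_of_antitone (a := a) (w := w) (N₁ := M + 1) (N₂ := M₂) (M := B)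
    (by omega) (by omega) hw hw0 hpart
  have heq : ∑ n ∈ Icc (M + 1) M₂, (w n : ℂ) * a n = ∑ n ∈ Ioc M M₂, b n * w n := by
    rw [← Finset.Icc_add_one_left_eq_Ioc]
    refine sum_congr rfl fun n hn ↦ ?_
    rw [mem_Icc] at hn
    rw [ha]; dsimp only
    rw [if_pos (by omega), mul_comm]
  rwa [heq] at h

/-! ## The Richert-type bound -/

/-- The weight `w(n) = n^{-σ} ((1 − n/x)⁺)³` is non-negative. [folklore] -/
theorem weight_nonneg (σ x : ℝ) (n : ℕ) : 0 ≤ (n : ℝ) ^ (-σ) * (max (1 - (n : ℝ) / x) 0) ^ 3 := by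
  have : 0 ≤ max (1 - (n : ℝ) / x) 0 := le_max_right _ _
  positivity

/-- The weight `w(n) = n^{-σ} ((1 − n/x)⁺)³` is non-increasing in `n ≥ 1` (`σ ≥ 0`, `x > 0`). [folklore] -/
theorem weight_antitone {σ x : ℝ} (hσ : 0 ≤ σ) (hx : 0 < x) {i : ℕ} (hi : 1 ≤ i) :
    ((i + 1 : ℕ) : ℝ) ^ (-σ) * (max (1 - ((i + 1 : ℕ) : ℝ) / x) 0) ^ 3 ≤
      (i : ℝ) ^ (-σ) * (max (1 - (i : ℝ) / x) 0) ^ 3 := by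
  have hi0 : (0 : ℝ) < i := by exact_mod_cast hi
  have h1 : ((i + 1 : ℕ) : ℝ) ^ (-σ) ≤ (i : ℝ) ^ (-σ) :=
    Real.rpow_le_rpow_of_nonpos hi0 (by push_cast; linarith) (by linarith)
  have h2 : max (1 - ((i + 1 : ℕ) : ℝ) / x) 0 ≤ max (1 - (i : ℝ) / x) 0 := by
    refine max_le_max ?_ le_rfl
    have : (i : ℝ) / x ≤ ((i + 1 : ℕ) : ℝ) / x := by
      gcongr; linarith
    linarith
  have h3 : 0 ≤ max (1 - ((i + 1 : ℕ) : ℝ) / x) 0 := le_max_right _ _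
  exact mul_le_mul h1 (pow_le_pow_left₀ h3 h2 3) (by positivity) (Real.rpow_nonneg hi0.le _)

/-- The weight is at most `n^{-σ} ≤ M^{-σ}` for `n ≥ M ≥ 1`, `σ ≥ 0`, `x > 0`. [folklore] -/
theorem weight_le {σ x : ℝ} (hσ : 0 ≤ σ) (hx : 0 < x) {M n : ℕ} (hM : 1 ≤ M) (hn : M ≤ n) :
    (n : ℝ) ^ (-σ) * (max (1 - (n : ℝ) / x) 0) ^ 3 ≤ (M : ℝ) ^ (-σ) := by
  have hM0 : (0 : ℝ) < M := by exact_mod_cast hM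
  have h1 : (n : ℝ) ^ (-σ) ≤ (M : ℝ) ^ (-σ) :=
    Real.rpow_le_rpow_of_nonpos hM0 (by exact_mod_cast hn) (by linarith)
  have h2 : max (1 - (n : ℝ) / x) 0 ≤ 1 := by
    refine max_le ?_ zero_le_one
    have : 0 ≤ (n : ℝ) / x := by positivity
    linarith
  have h3 : 0 ≤ max (1 - (n : ℝ) / x) 0 := le_max_right _ _
  calc (n : ℝ) ^ (-σ) * (max (1 - (n : ℝ) / x) 0) ^ 3 ≤ (M : ℝ) ^ (-σ) * 1 ^ 3 := by
        exact mul_le_mul h1 (pow_le_pow_left₀ h3 h2 3) (by positivity) (Real.rpow_nonneg hM0.le _)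
    _ = (M : ℝ) ^ (-σ) := by ring

/-- **One dyadic block.**  Under `LatticeExpSumBound C D`: for `m ≥ 1`, `σ ≥ 0`, `x > 0`, `M = 2^j ≥ 1` with
`M < M₂ ≤ 2M`, `M ≤ V⁴` (`V = m + |t| + 3`, `ℓ = log V > 0`),
`‖∑_{M < n ≤ M₂} c_m(n) n^{-it} w(n)‖ ≤ 2C · exp(max(1−σ,0)·(j log 2) − (j log 2)³/(D ℓ²))`. [folklore] -/
theorem norm_block_le {C D : ℝ} (h : LatticeExpSumBound C D) (hC : 0 ≤ C) {m : ℕ} (hm : 1 ≤ m)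
    {σ t x : ℝ} (hσ : 0 ≤ σ) (hx : 0 < x) {j M₂ : ℕ} (hM₂ : 2 ^ j < M₂) (hM₂' : M₂ ≤ 2 * 2 ^ j)
    (hMV : ((2 ^ j : ℕ) : ℝ) ≤ ((m : ℝ) + |t| + 3) ^ 4) :
    ‖∑ n ∈ Ioc (2 ^ j) M₂, cCoeff m n * (n : ℂ) ^ (-(t * I)) *
        (((n : ℝ) ^ (-σ) * (max (1 - (n : ℝ) / x) 0) ^ 3 : ℝ) : ℂ)‖ ≤
      2 * C * Real.exp (max (1 - σ) 0 * (j * Real.log 2) -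
        (j * Real.log 2) ^ 3 / (D * Real.log ((m : ℝ) + |t| + 3) ^ 2)) := by
  set V : ℝ := (m : ℝ) + |t| + 3 with hV
  set ℓ : ℝ := Real.log V with hℓ
  set M : ℕ := 2 ^ j with hMdef
  have hM1 : 1 ≤ M := Nat.one_le_two_pow
  have hM0 : (0 : ℝ) < M := by exact_mod_cast hM1
  have hMR : (M : ℝ) = (2 : ℝ) ^ j := by rw [hMdef]; push_cast; ring
  -- the partial sums over the block
  set B : ℝ := C * (M : ℝ) ^ (1 - Real.log M ^ 2 / (D * ℓ ^ 2)) with hB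
  have hBound : ∀ u, M ≤ u → u ≤ M₂ → ‖∑ n ∈ Ioc M u, cCoeff m n * (n : ℂ) ^ (-(t * I))‖ ≤ B := by
    intro u hu1 hu2
    rw [sum_Ioc_cCoeff_mul_eq]
    exact h m t M u hm hM1 hu1 (hu2.trans hM₂') hMV
  have hAbel := norm_sum_Ioc_mul_le (b := fun n ↦ cCoeff m n * (n : ℂ) ^ (-(t * I)))
    (w := fun n ↦ (n : ℝ) ^ (-σ) * (max (1 - (n : ℝ) / x) 0) ^ 3) (B := B) hM₂
    (fun i hi _ ↦ weight_antitone hσ hx (by omega)) (weight_nonneg σ x M₂) hBound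
  refine hAbel.trans ?_
  -- `w(M+1) ≤ M^{-σ}`
  have hw : ((M + 1 : ℕ) : ℝ) ^ (-σ) * (max (1 - ((M + 1 : ℕ) : ℝ) / x) 0) ^ 3 ≤ (M : ℝ) ^ (-σ) :=
    weight_le hσ hx hM1 (by omega)
  have hB0 : 0 ≤ B := by rw [hB]; positivity
  calc 2 * B * (((M + 1 : ℕ) : ℝ) ^ (-σ) * (max (1 - ((M + 1 : ℕ) : ℝ) / x) 0) ^ 3)
      ≤ 2 * B * (M : ℝ) ^ (-σ) := by gcongr
    _ = 2 * C * (((2 : ℝ) ^ j) ^ (-σ) * ((2 : ℝ) ^ j) ^ (1 - Real.log ((2 : ℝ) ^ j) ^ 2 / (D * ℓ ^ 2))) := by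
        rw [hB, hMR]; ring
    _ = 2 * C * Real.exp ((1 - σ) * (j * Real.log 2) - (j * Real.log 2) ^ 3 / (D * ℓ ^ 2)) := by
        rw [dyadic_term_eq]
    _ ≤ 2 * C * Real.exp (max (1 - σ) 0 * (j * Real.log 2) - (j * Real.log 2) ^ 3 / (D * ℓ ^ 2)) := by
        gcongr
        · exact le_max_left _ _

/-- The dyadic exponent against the Richert exponent: `exp(m₊ v − v³/(Dℓ²)) ≤ V^{B_D m₊^{3/2}}` for
`m₊, v ≥ 0`, `ℓ = log V > 0`. [cite: Ford2002, Lemma 7.3 (proof)] -/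
theorem exp_dyadic_le_rpow {mp v D V : ℝ} (hmp : 0 ≤ mp) (hv : 0 ≤ v) (hD : 0 < D) (hV : 1 < V) :
    Real.exp (mp * v - v ^ 3 / (D * Real.log V ^ 2)) ≤ V ^ (Bexp D * mp ^ (3 / 2 : ℝ)) := by
  have hℓ : 0 < Real.log V := Real.log_pos hV
  have h := cubic_bound hmp hv hD hℓ
  rw [Real.rpow_def_of_pos (by linarith), Real.exp_le_exp]
  calc mp * v - v ^ 3 / (D * Real.log V ^ 2) ≤ Bexp D * mp ^ (3 / 2 : ℝ) * Real.log V := h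
    _ = Real.log V * (Bexp D * mp ^ (3 / 2 : ℝ)) := by ring

/-- `N(log 2) ≤ 4 log V` forces `N + 1 ≤ 7 log V` when `2^N ≤ V⁴`, `V ≥ 4`. [folklore] -/
theorem count_blocks_le {N : ℕ} {V : ℝ} (hV : 4 ≤ V) (hN : (2 : ℝ) ^ N ≤ V ^ 4) :
    (N : ℝ) + 1 ≤ 7 * Real.log V := by
  have hV0 : 0 < V := by linarith
  have hlog2 : 0.6931 < Real.log 2 := by have := Real.log_two_gt_d9; linarith
  have hlogV : Real.log 4 ≤ Real.log V := Real.log_le_log (by norm_num) hV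
  have hlog4 : 1.38 < Real.log 4 := by
    have : Real.log 4 = 2 * Real.log 2 := by
      rw [show (4 : ℝ) = 2 ^ 2 by norm_num, Real.log_pow]; ring
    rw [this]; linarith
  have h1 : (N : ℝ) * Real.log 2 ≤ 4 * Real.log V := by
    have := Real.log_le_log (by positivity) hN
    rw [Real.log_pow, Real.log_pow] at this
    push_cast at this
    linarith
  nlinarith

set_option maxHeartbeats 1600000 in
/-- **The Richert-type bound for `D_m = 4 L(·, λ^m)` from the lattice exponential-sum hypothesis.**
If `LatticeExpSumBound C D` (`C ≥ 0`, `D > 0`), then there is `A ≥ 1` such that for all `m ≥ 1`, `1/2 ≤ σ ≤ 2` and real `t`,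
`‖D_m(σ + it)‖ ≤ A · log V · V^{B_D · max(1−σ,0)^{3/2}}`, `V = m + |t| + 3`, `B_D = (2/3)√(D/3)`.
Proof: `RieszPerron3.norm_apply_zero_le` with `f(n) = c_m(n) n^{-s₀}`, `Φ(u) = D_m(s₀ + u)`,
`c = max(1−σ,0) + 1/log V`, `x = V⁴`, `A = D₀ = ∑' N(z)^{-3/2}`, `K₁ = |t| + 2m + 4 ≤ 2V`; then dyadic blocks
(`norm_block_le`, `exp_dyadic_le_rpow`, at most `7 log V` of them). [cite: Titchmarsh1986, §5.3]
[cite: ColemanMathematika1990, Theorem 2 (proof)] -/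
theorem exists_richert_of_latticeExpSumBound {C D : ℝ} (h : LatticeExpSumBound C D) (hC : 0 ≤ C) (hD : 0 < D) :
    ∃ A : ℝ, 1 ≤ A ∧ ∀ (m : ℕ), 1 ≤ m → ∀ (σ t : ℝ), 1 / 2 ≤ σ → σ ≤ 2 →
      ‖heckeL m (σ + t * I)‖ ≤ A * Real.log ((m : ℝ) + |t| + 3) *
        ((m : ℝ) + |t| + 3) ^ (Bexp D * (max (1 - σ) 0) ^ (3 / 2 : ℝ)) := by
  -- the convexity constant
  set D₀ : ℝ := ∑' x : GaussianInt, ((x.norm : ℤ) : ℝ) ^ (-(3 / 2 : ℝ)) with hD₀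
  have hD₀ : 0 < D₀ := normSum_pos (by norm_num)
  refine ⟨4 + 12288 * D₀ * 4 + 14 * C + 1, by nlinarith, fun m hm σ t hσ hσ2 ↦ ?_⟩
  have hm0 : m ≠ 0 := by omega
  -- ### the parameters
  set V : ℝ := (m : ℝ) + |t| + 3 with hVdef
  have hm1 : (1 : ℝ) ≤ m := by exact_mod_cast hm
  have hV4 : 4 ≤ V := by rw [hVdef]; linarith [abs_nonneg t]
  have hV1 : 1 < V := by linarith
  have hV0 : 0 < V := by linarith
  set ℓ : ℝ := Real.log V with hℓdef
  have hℓ1 : 1 ≤ ℓ := by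
    rw [hℓdef, ← Real.log_exp 1]
    refine Real.log_le_log (Real.exp_pos 1) ?_
    have := Real.exp_one_lt_d9; linarith
  have hℓ0 : 0 < ℓ := by linarith
  set mp : ℝ := max (1 - σ) 0 with hmpdef
  have hmp0 : 0 ≤ mp := le_max_right _ _
  have hmp1 : mp ≤ 1 / 2 := max_le (by linarith) (by norm_num)
  set c : ℝ := mp + 1 / ℓ with hcdef
  have hc0 : 0 < c := by rw [hcdef]; positivity
  have hc1 : 1 / ℓ ≤ 1 := by rw [div_le_one hℓ0]; exact hℓ1
  have hcle : c ≤ 3 / 2 := by rw [hcdef]; linarith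
  set x : ℝ := V ^ 4 with hxdef
  have hx1 : 1 ≤ x := by rw [hxdef]; exact one_le_pow₀ hV1.le
  have hx0 : 0 < x := by linarith
  set s₀ : ℂ := (σ : ℂ) + t * I with hs₀def
  have hs₀re : s₀.re = σ := by simp [hs₀def]
  have hs₀im : s₀.im = t := by simp [hs₀def]
  -- ### the continued function and its bound
  set Φ : ℂ → ℂ := fun u ↦ heckeL m (s₀ + u) with hΦdef
  have hΦd : Differentiable ℂ Φ := (differentiable_heckeL hm0).comp (differentiable_id.const_add s₀)
  set K₁ : ℝ := |t| + 2 * m + 4 with hK₁def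
  have hK₁1 : 1 ≤ K₁ := by rw [hK₁def]; linarith [abs_nonneg t]
  have hK₁V : K₁ ≤ 2 * V := by rw [hK₁def, hVdef]; linarith [abs_nonneg t]
  have hbound : ∀ u : ℂ, -3 / 4 ≤ u.re → u.re ≤ c → ‖Φ u‖ ≤ D₀ * (K₁ + |u.im|) ^ 2 := by
    intro u hu1 hu2
    have hre : (s₀ + u).re = σ + u.re := by simp [hs₀def]
    have him : (s₀ + u).im = t + u.im := by simp [hs₀def]
    have h1 : -1 / 2 ≤ (s₀ + u).re := by rw [hre]; linarith
    have hσmp : σ + mp ≤ 2 := by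
      rw [hmpdef]
      rcases le_or_gt σ 1 with hσ1 | hσ1
      · rw [max_eq_left (by linarith)]; linarith
      · rw [max_eq_right (by linarith)]; linarith
    have h2 : (s₀ + u).re ≤ 3 := by rw [hre]; linarith
    have hb := norm_heckeL_le_mul_sq' hm0 h1 h2
    rw [him] at hb
    refine hb.trans (mul_le_mul_of_nonneg_left ?_ hD₀.le)
    have habs : |t + u.im| ≤ |t| + |u.im| := abs_add_le _ _
    have h0 : 0 ≤ |t + u.im| + 2 * m + 4 := by positivity
    apply pow_le_pow_left₀ h0
    rw [hK₁def]; linarith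
  -- ### the coefficients `f(n) = c_m(n) n^{-s₀}`
  set f : ℕ → ℂ := fun n ↦ cCoeff m n / (n : ℂ) ^ s₀ with hfdef
  have hterm : ∀ (u : ℂ) (n : ℕ), LSeries.term f u n = LSeries.term (cCoeff m) (s₀ + u) n := by
    intro u n
    rcases eq_or_ne n 0 with rfl | hn
    · simp [LSeries.term_zero]
    · rw [LSeries.term_of_ne_zero hn, LSeries.term_of_ne_zero hn, hfdef]
      dsimp only
      rw [div_div, ← cpow_add _ _ (Nat.cast_ne_zero.2 hn)]
  have hσc : 1 < σ + c := by
    rw [hcdef, hmpdef]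
    have : 1 - σ ≤ max (1 - σ) 0 := le_max_left _ _
    have : 0 < 1 / ℓ := by positivity
    linarith
  have hsum : LSeriesSummable f c := by
    have hs : 1 < (s₀ + c).re := by simp [hs₀def]; exact hσc
    have := LSeriesSummable_cCoeff m hs
    unfold LSeriesSummable at this ⊢
    exact this.congr fun n ↦ (hterm c n).symm
  have hL : ∀ y : ℝ, LSeries f (c + y * I) = Φ (c + y * I) := by
    intro y
    have hs : 1 < (s₀ + (c + y * I)).re := by simp [hs₀def]; exact hσc
    rw [hΦdef]; dsimp only
    rw [heckeL_eq_LSeries m hs, LSeries, LSeries]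
    exact tsum_congr fun n ↦ hterm _ n
  -- ### Perron + shift
  have hP := RieszPerron3.norm_apply_zero_le f hΦd hc0 hx1 hD₀.le hK₁1 hbound hsum hL
  have hΦ0 : Φ 0 = heckeL m (σ + t * I) := by simp [hΦdef, hs₀def]
  rw [hΦ0] at hP
  -- ### the error term `12288 D₀ K₁² x^{-3/4} ≤ 12288 D₀ · 4`
  have herr : 12288 * D₀ * K₁ ^ 2 * x ^ (-(3 / 4 : ℝ)) ≤ 12288 * D₀ * 4 := by
    have hx34 : x ^ (-(3 / 4 : ℝ)) = V ^ (-(3 : ℝ)) := by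
      rw [hxdef, ← Real.rpow_natCast V 4, ← Real.rpow_mul hV0.le]; norm_num
    rw [hx34]
    have hK2 : K₁ ^ 2 ≤ 4 * V ^ 2 := by nlinarith [hK₁V, hK₁1]
    have hV3 : V ^ (-(3 : ℝ)) = (V ^ 3)⁻¹ := by
      rw [Real.rpow_neg hV0.le, Real.rpow_ofNat]
    rw [hV3]
    have hV31 : 4 * V ^ 2 * (V ^ 3)⁻¹ ≤ 4 := by
      rw [mul_inv_le_iff₀ (by positivity)]
      nlinarith [hV4, sq_nonneg V]
    calc 12288 * D₀ * K₁ ^ 2 * (V ^ 3)⁻¹ ≤ 12288 * D₀ * (4 * V ^ 2) * (V ^ 3)⁻¹ := by gcongr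
      _ = 12288 * D₀ * (4 * V ^ 2 * (V ^ 3)⁻¹) := by ring
      _ ≤ 12288 * D₀ * 4 := by gcongr
  -- ### the main sum: `x⁻³ ∑ f(n)(x−n)³ = ∑ c_m(n) n^{-it} w(n)`
  set X : ℕ := ⌊x⌋₊ with hXdef
  have hX1 : 1 ≤ X := by rw [hXdef]; exact Nat.le_floor (by simpa using hx1)
  have hXx : (X : ℝ) ≤ x := Nat.floor_le hx0.le
  set w : ℕ → ℝ := fun n ↦ (n : ℝ) ^ (-σ) * (max (1 - (n : ℝ) / x) 0) ^ 3 with hwdef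
  set g : ℕ → ℂ := fun n ↦ cCoeff m n * (n : ℂ) ^ (-(t * I)) * ((w n : ℝ) : ℂ) with hgdef
  have hterms : ∀ n ∈ Ioc 0 X, f n * ((x : ℂ) - n) ^ 3 = (x : ℂ) ^ 3 * g n := by
    intro n hn
    rw [mem_Ioc] at hn
    have hn0 : n ≠ 0 := by omega
    have hnx : (n : ℝ) ≤ x := le_trans (by exact_mod_cast hn.2) hXx
    have hnpos : (0 : ℝ) < n := by exact_mod_cast hn.1
    have hmax : max (1 - (n : ℝ) / x) 0 = 1 - (n : ℝ) / x := max_eq_left (by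
      rw [sub_nonneg, div_le_one hx0]; exact hnx)
    -- `n^{-s₀} = n^{-σ} n^{-it}`
    have hnC : (n : ℂ) ≠ 0 := Nat.cast_ne_zero.2 hn0
    have hsplit : ((n : ℂ) ^ s₀)⁻¹ = (((n : ℝ) ^ (-σ) : ℝ) : ℂ) * (n : ℂ) ^ (-(t * I)) := by
      rw [← cpow_neg, hs₀def, show -((σ : ℂ) + t * I) = ((-σ : ℝ) : ℂ) + -(t * I) by push_cast; ring,
        cpow_add _ _ hnC, Complex.ofReal_cpow hnpos.le]
      push_cast; ring
    rw [hgdef, hwdef, hfdef]; dsimp only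
    rw [hmax, div_eq_mul_inv, hsplit]
    have hxC : (x : ℂ) ≠ 0 := ofReal_ne_zero.2 hx0.ne'
    push_cast
    field_simp
  have hmain_eq : x ^ (-(3 : ℝ)) * ‖∑ n ∈ Ioc 0 X, f n * ((x : ℂ) - n) ^ 3‖ = ‖∑ n ∈ Ioc 0 X, g n‖ := by
    rw [sum_congr rfl hterms, ← mul_sum, norm_mul]
    have : ‖(x : ℂ) ^ 3‖ = x ^ (3 : ℝ) := by
      rw [norm_pow, Complex.norm_real, Real.norm_of_nonneg hx0.le, Real.rpow_ofNat]
    rw [this, ← mul_assoc, ← Real.rpow_add hx0]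
    norm_num
  rw [hmain_eq] at hP
  -- ### dyadic decomposition of `∑_{n ≤ X} g(n)`
  set J : ℕ := Nat.log 2 X with hJdef
  have hJ1 : 2 ^ J ≤ X := by rw [hJdef]; exact Nat.pow_log_le_self 2 (by omega)
  have hJ2 : X < 2 ^ (J + 1) := by rw [hJdef]; exact Nat.lt_pow_succ_log_self (by norm_num) X
  set cc : ℕ → ℕ := fun j ↦ min (2 ^ j) X with hccdef
  have hcc0 : cc 0 = 1 := by rw [hccdef]; dsimp only; rw [pow_zero]; exact min_eq_left hX1
  have hccJ : cc (J + 1) = X := by rw [hccdef]; dsimp only; exact min_eq_right hJ2.le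
  have hcc_mono : ∀ j, cc j ≤ cc (j + 1) := fun j ↦ by
    rw [hccdef]; dsimp only
    exact min_le_min (Nat.pow_le_pow_right (by norm_num) (by omega)) le_rfl
  set S : ℕ → ℂ := fun N ↦ ∑ n ∈ Ioc 0 N, g n with hSdef
  have htel : S X = S 1 + ∑ j ∈ range (J + 1), (S (cc (j + 1)) - S (cc j)) := by
    rw [Finset.sum_range_sub (fun j ↦ S (cc j)), hccJ, hcc0]; ring
  have hblock : ∀ j, S (cc (j + 1)) - S (cc j) = ∑ n ∈ Ioc (cc j) (cc (j + 1)), g n := by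
    intro j
    rw [hSdef]; dsimp only
    rw [← sum_Ioc_consecutive g (Nat.zero_le _) (hcc_mono j)]; ring
  -- `S 1 = g 1`, `‖g 1‖ ≤ 4`
  have hS1 : ‖S 1‖ ≤ 4 := by
    have : S 1 = g 1 := by
      rw [hSdef]; dsimp only
      rw [show Ioc 0 1 = {1} by rfl, sum_singleton]
    rw [this, hgdef]; dsimp only
    rw [cCoeff_one, norm_mul, norm_mul, Complex.norm_real]
    have h1 : ‖((1 : ℕ) : ℂ) ^ (-(t * I))‖ = 1 := by
      rw [Nat.cast_one, one_cpow, norm_one]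
    rw [h1, mul_one]
    have hw1 : ‖w 1‖ ≤ 1 := by
      rw [Real.norm_of_nonneg (weight_nonneg σ x 1)]
      have := weight_le (σ := σ) (x := x) (by linarith) hx0 (M := 1) (n := 1) le_rfl le_rfl
      simpa using this
    calc ‖(4 : ℂ)‖ * ‖w 1‖ ≤ 4 * 1 := by gcongr; simp
      _ = 4 := by ring
  -- each block
  have hE : ∀ j ∈ range (J + 1), ‖S (cc (j + 1)) - S (cc j)‖ ≤ 2 * C * V ^ (Bexp D * mp ^ (3 / 2 : ℝ)) := by
    intro j hj
    rw [mem_range] at hj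
    have hjJ : j ≤ J := by omega
    have h2j : 2 ^ j ≤ X := le_trans (Nat.pow_le_pow_right (by norm_num) hjJ) hJ1
    have hccj : cc j = 2 ^ j := by rw [hccdef]; dsimp only; exact min_eq_left h2j
    rw [hblock j, hccj]
    rcases eq_or_lt_of_le (hccj ▸ hcc_mono j : 2 ^ j ≤ cc (j + 1)) with heq | hlt
    · rw [← heq, Ioc_self, sum_empty, norm_zero]
      have : 0 ≤ V ^ (Bexp D * mp ^ (3 / 2 : ℝ)) := Real.rpow_nonneg hV0.le _
      positivity
    · have hM₂' : cc (j + 1) ≤ 2 * 2 ^ j := by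
        rw [hccdef]; dsimp only
        calc min (2 ^ (j + 1)) X ≤ 2 ^ (j + 1) := min_le_left _ _
          _ = 2 * 2 ^ j := by ring
      have hMV : ((2 ^ j : ℕ) : ℝ) ≤ V ^ 4 := le_trans (by exact_mod_cast h2j) hXx
      have hb := norm_block_le h hC hm (σ := σ) (t := t) (by linarith) hx0 hlt hM₂' hMV
      refine hb.trans ?_
      have hv0 : 0 ≤ (j : ℝ) * Real.log 2 := by
        have := Real.log_pos (show (1 : ℝ) < 2 by norm_num); positivity
      have := exp_dyadic_le_rpow (v := (j : ℝ) * Real.log 2) hmp0 hv0 hD hV1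
      exact mul_le_mul_of_nonneg_left this (by positivity)
  -- number of blocks
  have hJℓ : ((J + 1 : ℕ) : ℝ) ≤ 7 * ℓ := by
    have h2J : (2 : ℝ) ^ J ≤ V ^ 4 := by
      have : ((2 ^ J : ℕ) : ℝ) ≤ x := le_trans (by exact_mod_cast hJ1) hXx
      rw [hxdef] at this; push_cast at this; exact this
    have := count_blocks_le hV4 h2J
    push_cast; exact this
  have hmain : ‖∑ n ∈ Ioc 0 X, g n‖ ≤ 4 + 7 * ℓ * (2 * C * V ^ (Bexp D * mp ^ (3 / 2 : ℝ))) := by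
    have hSX : ∑ n ∈ Ioc 0 X, g n = S X := rfl
    rw [hSX, htel]
    refine (norm_add_le _ _).trans (add_le_add hS1 ?_)
    calc ‖∑ j ∈ range (J + 1), (S (cc (j + 1)) - S (cc j))‖
        ≤ ∑ j ∈ range (J + 1), ‖S (cc (j + 1)) - S (cc j)‖ := norm_sum_le _ _
      _ ≤ ∑ _j ∈ range (J + 1), 2 * C * V ^ (Bexp D * mp ^ (3 / 2 : ℝ)) := sum_le_sum hE
      _ = ((J + 1 : ℕ) : ℝ) * (2 * C * V ^ (Bexp D * mp ^ (3 / 2 : ℝ))) := by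
          rw [sum_const, card_range, nsmul_eq_mul]
      _ ≤ 7 * ℓ * (2 * C * V ^ (Bexp D * mp ^ (3 / 2 : ℝ))) := by
          have : 0 ≤ 2 * C * V ^ (Bexp D * mp ^ (3 / 2 : ℝ)) := by
            have := Real.rpow_nonneg hV0.le (Bexp D * mp ^ (3 / 2 : ℝ)); positivity
          exact mul_le_mul_of_nonneg_right hJℓ this
  -- ### conclusion
  have hVE : 1 ≤ V ^ (Bexp D * mp ^ (3 / 2 : ℝ)) :=
    Real.one_le_rpow hV1.le (by have := Bexp_nonneg D; positivity)
  have hP' := hP.trans (add_le_add hmain herr)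
  refine hP'.trans ?_
  set E : ℝ := V ^ (Bexp D * mp ^ (3 / 2 : ℝ)) with hEdef
  have hE0 : 0 ≤ E := by linarith
  have hℓE : 1 ≤ ℓ * E := one_le_mul_of_one_le_of_one_le hℓ1 hVE
  -- `4 ≤ 4 ℓ E`, `12288 D₀ 4 ≤ 12288 D₀ 4 ℓ E`, `7ℓ·2C E = 14 C ℓ E`
  have h1 : (4 : ℝ) ≤ 4 * (ℓ * E) := by nlinarith
  have h2 : 12288 * D₀ * 4 ≤ 12288 * D₀ * 4 * (ℓ * E) := by nlinarith
  have h3 : 0 ≤ 1 * (ℓ * E) := by positivity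
  calc 4 + 7 * ℓ * (2 * C * E) + 12288 * D₀ * 4
      ≤ 4 * (ℓ * E) + 14 * C * (ℓ * E) + 12288 * D₀ * 4 * (ℓ * E) + 1 * (ℓ * E) := by nlinarith
    _ = (4 + 12288 * D₀ * 4 + 14 * C + 1) * ℓ * E := by ring

end GaussianHecke

end Literature.NumberTheory.LFunctions
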